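import Mathlib
import HarnessLib
import Literature.MathematicalPhysics.QuantumLattice.GrassmannParity
import Literature.MathematicalPhysics.QuantumLattice.GrassmannPairLaplacians
import Literature.MathematicalPhysics.QuantumLattice.GrassmannLaplacianPairWick
import Literature.MathematicalPhysics.QuantumLattice.FejerTopCutoff
import Summits.HubbardSuperconductivity.HubbardSuperconductivity.Theorems.KLProgrammeKLRegimeVolumeLimitHartree
import Summits.HubbardSuperconductivity.HubbardSuperconductivity.Theorems.KLProgrammeKLRegimeVolumeLimitSecondOrder

/-!
# Child `KLRegimeVolumeLimit` (stmt-HubbardSuperconductivity-19665 / its gen-3 twin) — the ORDER-`U²` RUNG of the volume-limit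
# carrier, Wick evaluation I: reduction of the second cumulant to `∫ ∂⁺W·∂⁻W` and the tadpole-with-tadpole-insertion
# (seat hubbard-kl-k3c5-p3)

`…VolumeLimitSecondOrder` gives `d²/dU²|₀ Σ̂^K(k,σ;U) = K₂(k,σ)/(βL² ĝ_K(k)²)` with the second cumulant
`K₂ = N₂ − N₀D₂ − 2D₁(N₁ − N₀D₁)` of the bare Gaussian measure (`N_j = ∫ψ̂⁺_{kσ}ψ̂⁻_{kσ}Wʲ`, `D_j = ∫Wʲ`, `W = V(1)`).  `K₂` is
evaluated by Wick's rule STRUCTURALLY rather than by a `5 × 5` Pfaffian; this module carries the first three steps: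

* `§1` two integrations by parts on the external legs: `∫ψ̂⁺ψ̂⁻ G − ⟨ψ̂⁺ψ̂⁻⟩∫G = (βL² ĝ(k))² ∫ ∂⁺_{kσ}∂⁻_{kσ} G` (any `G`), so
  `K₂ = (βL² ĝ(k))² (∫∂⁺∂⁻(W²) − 2 ∫W ∫∂⁺∂⁻W)` (`secondCumulant_eq_deriv`);
* `§2` `W` is even, hence central, and the graded Leibniz rule is the plain one on it: `∂⁺∂⁻(W²) = 2(∂⁺W·∂⁻W + W·∂⁺∂⁻W)`, whence
  `K₂ = 2(βL² ĝ(k))² (∫∂⁺W·∂⁻W + Cov(W, ∂⁺∂⁻W))` (`secondCumulant_eq_two_mul`);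
* `§3` `∂⁺_{kσ}∂⁻_{kσ}W = −(βL²)⁻³ Σ_q ψ̂⁺_{qσ̄}ψ̂⁻_{qσ̄}` (the opposite-spin density; exact cancellation in the vertex constraint,
  `matsubaraInt_injective`), and by the first-order identity of `…VolumeLimitHartree` at every `q`
  `Cov(W, ∂⁺∂⁻W) = −(βL²)⁻³ (Σ_q ĝ₀(q)²)(Σ_q ĝ₀(q))` — the TADPOLE WITH A TADPOLE INSERTION (`cov_hubbardInteraction_dd`).

The six-point function `∫∂⁺W·∂⁻W` (sunset + reducible double tadpole) is `…SecondOrderSunsetUp/Down`, the evaluated rung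
`…SecondOrderEval`.  Everything is proved; no definition.
-/

noncomputable section

namespace Summit.HubbardSuperconductivity.HubbardSuperconductivity.Theorems.TwoPointAssembly

set_option linter.dupNamespace false -- summit = problem name (single-conjunct summit), D-0017

open Finset Filter Topology Literature.MathematicalPhysics.QuantumLattice Literature.Probability.LatticeModels GrassmannAlgebra
open Summit.HubbardSuperconductivity.HubbardSuperconductivity.Theorems.KLRegimeSplit
open Summit.HubbardSuperconductivity.HubbardSuperconductivity.Theorems.KLProgrammeLegKernels

variable {L M : ℕ} [NeZero L]

/-! ## §1 Two integrations by parts on the external legs -/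

/-- **`∫ψ̂⁺_{kσ}ψ̂⁻_{kσ} a = −βL² ĝ_K(k) ∫a + (βL² ĝ_K(k))² ∫ ∂⁺_{kσ}∂⁻_{kσ} a`** (seedless frame covariance, `β ≠ 0`). -/
theorem gaussExpect_pair_mul_eq {β : ℝ} (hβ : β ≠ 0) (μ : ℝ) (K : TrigPolyC4v) (k : FreqMomentum L M) (σ : Fin 2)
    (a : HubbardGrassmann L M) :
    gaussExpect ℂ (hubbardCovarianceCT L M β μ 0 K)
        (gen ℂ (((k, σ), 0) : HubbardFieldIdx L M) * gen ℂ (((k, σ), 1) : HubbardFieldIdx L M) * a) =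
      -(((β * (L : ℝ) ^ 2 : ℝ) : ℂ) * propCT L M β μ K k) * gaussExpect ℂ (hubbardCovarianceCT L M β μ 0 K) a +
        (((β * (L : ℝ) ^ 2 : ℝ) : ℂ) * propCT L M β μ K k) ^ 2 *
          gaussExpect ℂ (hubbardCovarianceCT L M β μ 0 K)
            (grassmannDeriv ℂ (((k, σ), 0) : HubbardFieldIdx L M) (grassmannDeriv ℂ (((k, σ), 1) : HubbardFieldIdx L M) a)) := by
  rw [mul_assoc, gaussExpect_psiPlus_mul hβ, grassmannDeriv_gen_mul, if_pos rfl, map_sub, gaussExpect_psiMinus_mul hβ]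
  ring

/-- **Truncation by two integrations by parts**: `∫ψ̂⁺_{kσ}ψ̂⁻_{kσ} G − ⟨ψ̂⁺_{kσ}ψ̂⁻_{kσ}⟩ ∫G = (βL² ĝ_K(k))² ∫ ∂⁺_{kσ}∂⁻_{kσ} G`. -/
theorem gaussExpect_pair_mul_sub_eq {β : ℝ} (hβ : β ≠ 0) (μ : ℝ) (K : TrigPolyC4v) (k : FreqMomentum L M) (σ : Fin 2)
    (G : HubbardGrassmann L M) :
    gaussExpect ℂ (hubbardCovarianceCT L M β μ 0 K)
          (gen ℂ (((k, σ), 0) : HubbardFieldIdx L M) * gen ℂ (((k, σ), 1) : HubbardFieldIdx L M) * G) -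
        gaussExpect ℂ (hubbardCovarianceCT L M β μ 0 K)
            (gen ℂ (((k, σ), 0) : HubbardFieldIdx L M) * gen ℂ (((k, σ), 1) : HubbardFieldIdx L M)) *
          gaussExpect ℂ (hubbardCovarianceCT L M β μ 0 K) G =
      (((β * (L : ℝ) ^ 2 : ℝ) : ℂ) * propCT L M β μ K k) ^ 2 *
        gaussExpect ℂ (hubbardCovarianceCT L M β μ 0 K)
          (grassmannDeriv ℂ (((k, σ), 0) : HubbardFieldIdx L M) (grassmannDeriv ℂ (((k, σ), 1) : HubbardFieldIdx L M) G)) := by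
  rw [gaussExpect_pair_mul_eq hβ, gaussExpect_psiPlus_psiMinus hβ, if_pos ⟨rfl, rfl⟩]
  ring

/-- **The second cumulant after the external integrations by parts**:
`N₂ − N₀D₂ − 2D₁(N₁ − N₀D₁) = (βL² ĝ_K(k))² (∫∂⁺∂⁻(W²) − 2 ∫W · ∫∂⁺∂⁻W)` (any even or odd `W`; here `W = V(1)`). -/
theorem secondCumulant_eq_deriv {β : ℝ} (hβ : β ≠ 0) (μ : ℝ) (K : TrigPolyC4v) (k : FreqMomentum L M) (σ : Fin 2)
    (W : HubbardGrassmann L M) :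
    gaussExpect ℂ (hubbardCovarianceCT L M β μ 0 K)
            (gen ℂ (((k, σ), 0) : HubbardFieldIdx L M) * gen ℂ (((k, σ), 1) : HubbardFieldIdx L M) * W ^ 2) -
          gaussExpect ℂ (hubbardCovarianceCT L M β μ 0 K)
              (gen ℂ (((k, σ), 0) : HubbardFieldIdx L M) * gen ℂ (((k, σ), 1) : HubbardFieldIdx L M)) *
            gaussExpect ℂ (hubbardCovarianceCT L M β μ 0 K) (W ^ 2) -
        2 * gaussExpect ℂ (hubbardCovarianceCT L M β μ 0 K) W *
          (gaussExpect ℂ (hubbardCovarianceCT L M β μ 0 K)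
              (gen ℂ (((k, σ), 0) : HubbardFieldIdx L M) * gen ℂ (((k, σ), 1) : HubbardFieldIdx L M) * W) -
            gaussExpect ℂ (hubbardCovarianceCT L M β μ 0 K)
                (gen ℂ (((k, σ), 0) : HubbardFieldIdx L M) * gen ℂ (((k, σ), 1) : HubbardFieldIdx L M)) *
              gaussExpect ℂ (hubbardCovarianceCT L M β μ 0 K) W) =
      (((β * (L : ℝ) ^ 2 : ℝ) : ℂ) * propCT L M β μ K k) ^ 2 *
        (gaussExpect ℂ (hubbardCovarianceCT L M β μ 0 K)
            (grassmannDeriv ℂ (((k, σ), 0) : HubbardFieldIdx L M) (grassmannDeriv ℂ (((k, σ), 1) : HubbardFieldIdx L M) (W ^ 2))) -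
          2 * gaussExpect ℂ (hubbardCovarianceCT L M β μ 0 K) W *
            gaussExpect ℂ (hubbardCovarianceCT L M β μ 0 K)
              (grassmannDeriv ℂ (((k, σ), 0) : HubbardFieldIdx L M) (grassmannDeriv ℂ (((k, σ), 1) : HubbardFieldIdx L M) W))) := by
  rw [gaussExpect_pair_mul_sub_eq hβ, mul_assoc (2 : ℂ), mul_assoc (2 : ℂ), gaussExpect_pair_mul_sub_eq hβ]
  ring

/-! ## §2 `W = V(1)` is even (`hubbardInteraction_mem_evenOdd_zero`, `…TwoPointAssemblyRepr`): the Leibniz rule for `∂⁺∂⁻(W²)` -/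

omit [NeZero L] in
/-- **Leibniz for the square of an even element**: `∂_X ∂_Y (W²) = 2 (∂_X W · ∂_Y W + W · ∂_X ∂_Y W)`. -/
theorem grassmannDeriv_grassmannDeriv_sq_of_mem_evenOdd_zero (X Y : HubbardFieldIdx L M) {W : HubbardGrassmann L M}
    (hW : W ∈ evenOdd ℂ (0 : ZMod 2)) :
    grassmannDeriv ℂ X (grassmannDeriv ℂ Y (W ^ 2)) =
      (2 : ℂ) • (grassmannDeriv ℂ X W * grassmannDeriv ℂ Y W + W * grassmannDeriv ℂ X (grassmannDeriv ℂ Y W)) := by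
  have h1 : grassmannDeriv ℂ Y (W ^ 2) = (2 : ℂ) • (W * grassmannDeriv ℂ Y W) := by
    rw [pow_two, grassmannDeriv_mul_of_mem_evenOdd_zero ℂ Y hW, (commute_of_mem_evenOdd_zero ℂ hW _).eq, two_smul]
  rw [h1, map_smul, grassmannDeriv_mul_of_mem_evenOdd_zero ℂ X hW]

/-- **The second cumulant, reduced**: for `W = V(1)`,
`N₂ − N₀D₂ − 2D₁(N₁ − N₀D₁) = 2 (βL² ĝ_K(k))² (∫ ∂⁺W·∂⁻W + (∫ W·∂⁺∂⁻W − ∫W ∫∂⁺∂⁻W))`. -/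
theorem secondCumulant_eq_two_mul {β : ℝ} (hβ : β ≠ 0) (μ : ℝ) (K : TrigPolyC4v) (k : FreqMomentum L M) (σ : Fin 2) :
    gaussExpect ℂ (hubbardCovarianceCT L M β μ 0 K)
            (gen ℂ (((k, σ), 0) : HubbardFieldIdx L M) * gen ℂ (((k, σ), 1) : HubbardFieldIdx L M) *
              hubbardInteraction L M β 1 ^ 2) -
          gaussExpect ℂ (hubbardCovarianceCT L M β μ 0 K)
              (gen ℂ (((k, σ), 0) : HubbardFieldIdx L M) * gen ℂ (((k, σ), 1) : HubbardFieldIdx L M)) *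
            gaussExpect ℂ (hubbardCovarianceCT L M β μ 0 K) (hubbardInteraction L M β 1 ^ 2) -
        2 * gaussExpect ℂ (hubbardCovarianceCT L M β μ 0 K) (hubbardInteraction L M β 1) *
          (gaussExpect ℂ (hubbardCovarianceCT L M β μ 0 K)
              (gen ℂ (((k, σ), 0) : HubbardFieldIdx L M) * gen ℂ (((k, σ), 1) : HubbardFieldIdx L M) *
                hubbardInteraction L M β 1) -
            gaussExpect ℂ (hubbardCovarianceCT L M β μ 0 K)
                (gen ℂ (((k, σ), 0) : HubbardFieldIdx L M) * gen ℂ (((k, σ), 1) : HubbardFieldIdx L M)) *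
              gaussExpect ℂ (hubbardCovarianceCT L M β μ 0 K) (hubbardInteraction L M β 1)) =
      2 * (((β * (L : ℝ) ^ 2 : ℝ) : ℂ) * propCT L M β μ K k) ^ 2 *
        (gaussExpect ℂ (hubbardCovarianceCT L M β μ 0 K)
            (grassmannDeriv ℂ (((k, σ), 0) : HubbardFieldIdx L M) (hubbardInteraction L M β 1) *
              grassmannDeriv ℂ (((k, σ), 1) : HubbardFieldIdx L M) (hubbardInteraction L M β 1)) +
          (gaussExpect ℂ (hubbardCovarianceCT L M β μ 0 K)
              (hubbardInteraction L M β 1 *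
                grassmannDeriv ℂ (((k, σ), 0) : HubbardFieldIdx L M)
                  (grassmannDeriv ℂ (((k, σ), 1) : HubbardFieldIdx L M) (hubbardInteraction L M β 1))) -
            gaussExpect ℂ (hubbardCovarianceCT L M β μ 0 K) (hubbardInteraction L M β 1) *
              gaussExpect ℂ (hubbardCovarianceCT L M β μ 0 K)
                (grassmannDeriv ℂ (((k, σ), 0) : HubbardFieldIdx L M)
                  (grassmannDeriv ℂ (((k, σ), 1) : HubbardFieldIdx L M) (hubbardInteraction L M β 1))))) := by
  rw [secondCumulant_eq_deriv hβ,
    grassmannDeriv_grassmannDeriv_sq_of_mem_evenOdd_zero _ _ (hubbardInteraction_mem_evenOdd_zero L M β 1),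
    map_smul, map_add, smul_eq_mul]
  ring

/-! ## §3 The double derivative of the vertex is the opposite-spin density; its covariance with `W` -/

omit [NeZero L] in
/-- Conservation with a repeated leg on the left cancels: `k + q = k + q'` iff `q' = q`. -/
theorem vertexConstraint_cancel_left_iff (k q q' : FreqMomentum L M) :
    (matsubaraInt M k.1 + matsubaraInt M q.1 = matsubaraInt M k.1 + matsubaraInt M q'.1 ∧ k.2 + q.2 = k.2 + q'.2) ↔ q' = q := by
  constructor
  · rintro ⟨h1, h2⟩
    have h1' : q.1 = q'.1 := matsubaraInt_injective M (add_left_cancel h1)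
    have h2' : q.2 = q'.2 := add_left_cancel h2
    exact (Prod.ext h1' h2').symm
  · rintro rfl; exact ⟨rfl, rfl⟩

omit [NeZero L] in
/-- Conservation with a repeated leg on the right cancels: `k + q = k' + q` iff `k' = k`. -/
theorem vertexConstraint_cancel_right_iff (k k' q : FreqMomentum L M) :
    (matsubaraInt M k.1 + matsubaraInt M q.1 = matsubaraInt M k'.1 + matsubaraInt M q.1 ∧ k.2 + q.2 = k'.2 + q.2) ↔ k' = k := by
  constructor
  · rintro ⟨h1, h2⟩
    have h1' : k.1 = k'.1 := matsubaraInt_injective M (add_right_cancel h1)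
    have h2' : k.2 = k'.2 := add_right_cancel h2
    exact (Prod.ext h1' h2').symm
  · rintro rfl; exact ⟨rfl, rfl⟩

omit [NeZero L] in
/-- The Grassmann derivative of a guarded element. -/
theorem grassmannDeriv_ite (X : HubbardFieldIdx L M) (p : Prop) [Decidable p] (x : HubbardGrassmann L M) :
    grassmannDeriv ℂ X (if p then x else 0) = if p then grassmannDeriv ℂ X x else 0 := by
  split_ifs <;> simp

/-- **`∂⁺_{k↑}∂⁻_{k↑} W = −(βL²)⁻³ Σ_q ψ̂⁺_{q↓}ψ̂⁻_{q↓}`** — the spin-`↓` density. -/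
theorem dd_up_hubbardInteraction (β : ℝ) (k : FreqMomentum L M) :
    grassmannDeriv ℂ (((k, 0), 0) : HubbardFieldIdx L M) (grassmannDeriv ℂ (((k, 0), 1) : HubbardFieldIdx L M)
        (hubbardInteraction L M β 1)) =
      -((((1 / (β * (L : ℝ) ^ 2) ^ 3 : ℝ) : ℂ)) • ∑ q : FreqMomentum L M, psiPlus q 1 * psiMinus q 1) := by
  rw [hubbardInteraction]
  simp only [map_smul, map_sum, grassmannDeriv_ite, grassmannDeriv_psiMinus_up_vertexMonomial, map_neg,
    grassmannDeriv_psiPlus_up_three, ← smul_neg]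
  congr 1
  rw [← Finset.sum_neg_distrib]
  -- collapse `k₁ = k`, `k₂ = k`, then `k₄ = k₃`
  rw [Finset.sum_eq_single k]
  · rw [Finset.sum_eq_single k]
    · simp only [if_true, vertexConstraint_cancel_left_iff]
      refine Finset.sum_congr rfl fun k₃ _ => ?_
      rw [Finset.sum_ite_eq' Finset.univ k₃, if_pos (Finset.mem_univ _)]
    · intro k₂ _ h; simp [h]
    · intro h; exact absurd (Finset.mem_univ _) h
  · intro k₁ _ h; simp [h]
  · intro h; exact absurd (Finset.mem_univ _) h

/-- **`∂⁺_{k↓}∂⁻_{k↓} W = −(βL²)⁻³ Σ_q ψ̂⁺_{q↑}ψ̂⁻_{q↑}`** — the spin-`↑` density. -/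
theorem dd_down_hubbardInteraction (β : ℝ) (k : FreqMomentum L M) :
    grassmannDeriv ℂ (((k, 1), 0) : HubbardFieldIdx L M) (grassmannDeriv ℂ (((k, 1), 1) : HubbardFieldIdx L M)
        (hubbardInteraction L M β 1)) =
      -((((1 / (β * (L : ℝ) ^ 2) ^ 3 : ℝ) : ℂ)) • ∑ q : FreqMomentum L M, psiPlus q 0 * psiMinus q 0) := by
  rw [hubbardInteraction]
  simp only [map_smul, map_sum, grassmannDeriv_ite, grassmannDeriv_psiMinus_down_vertexMonomial, map_neg,
    grassmannDeriv_psiPlus_down_three, ← smul_neg]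
  congr 1
  rw [← Finset.sum_neg_distrib]
  refine Finset.sum_congr rfl fun k₁ _ => ?_
  -- collapse `k₃ = k`, `k₄ = k`, then `k₂ = k₁`
  have hswap : ∀ k₂ : FreqMomentum L M,
      (∑ k₃ : FreqMomentum L M, ∑ k₄ : FreqMomentum L M,
        if matsubaraInt M k₁.1 + matsubaraInt M k₃.1 = matsubaraInt M k₂.1 + matsubaraInt M k₄.1 ∧ k₁.2 + k₃.2 = k₂.2 + k₄.2 then
          -(if k₄ = k then (if k₃ = k then psiPlus k₁ 0 * psiMinus k₂ 0 else 0) else 0) else 0) =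
      -(if k₂ = k₁ then psiPlus k₁ 0 * psiMinus k₁ 0 else 0) := by
    intro k₂
    rw [Finset.sum_eq_single k]
    · rw [Finset.sum_eq_single k]
      · simp only [if_true, vertexConstraint_cancel_right_iff]
        by_cases h : k₂ = k₁
        · subst h; simp
        · simp [h]
      · intro k₄ _ h; simp [h]
      · intro h; exact absurd (Finset.mem_univ _) h
    · intro k₃ _ h
      exact Finset.sum_eq_zero fun k₄ _ => by simp [h]
    · intro h; exact absurd (Finset.mem_univ _) h
  simp only [hswap, Finset.sum_neg_distrib, Finset.sum_ite_eq' Finset.univ k₁, if_pos (Finset.mem_univ _)]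

/-- **The covariance of `W` with the opposite-spin density is the tadpole with a tadpole insertion**:
`∫ W·∂⁺_{kσ}∂⁻_{kσ}W − ∫W ∫∂⁺_{kσ}∂⁻_{kσ}W = −(βL²)⁻³ (Σ_q ĝ₀(q)²)(Σ_q ĝ₀(q))` (bare seedless covariance, `β ≠ 0`; any spin). -/
theorem cov_hubbardInteraction_dd {β : ℝ} (hβ : β ≠ 0) (μ : ℝ) (k : FreqMomentum L M) (σ : Fin 2) :
    gaussExpect ℂ (hubbardCovariance L M β μ 0)
          (hubbardInteraction L M β 1 *
            grassmannDeriv ℂ (((k, σ), 0) : HubbardFieldIdx L M)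
              (grassmannDeriv ℂ (((k, σ), 1) : HubbardFieldIdx L M) (hubbardInteraction L M β 1))) -
        gaussExpect ℂ (hubbardCovariance L M β μ 0) (hubbardInteraction L M β 1) *
          gaussExpect ℂ (hubbardCovariance L M β μ 0)
            (grassmannDeriv ℂ (((k, σ), 0) : HubbardFieldIdx L M)
              (grassmannDeriv ℂ (((k, σ), 1) : HubbardFieldIdx L M) (hubbardInteraction L M β 1))) =
      -((((1 / (β * (L : ℝ) ^ 2) ^ 3 : ℝ) : ℂ)) *
        ((∑ q : FreqMomentum L M, propCT L M β μ 0 q ^ 2) * ∑ q : FreqMomentum L M, propCT L M β μ 0 q)) := by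
  -- the opposite spin `τ`
  have key : ∀ τ : Fin 2,
      gaussExpect ℂ (hubbardCovariance L M β μ 0)
            (hubbardInteraction L M β 1 *
              -((((1 / (β * (L : ℝ) ^ 2) ^ 3 : ℝ) : ℂ)) • ∑ q : FreqMomentum L M, psiPlus q τ * psiMinus q τ)) -
          gaussExpect ℂ (hubbardCovariance L M β μ 0) (hubbardInteraction L M β 1) *
            gaussExpect ℂ (hubbardCovariance L M β μ 0)
              (-((((1 / (β * (L : ℝ) ^ 2) ^ 3 : ℝ) : ℂ)) • ∑ q : FreqMomentum L M, psiPlus q τ * psiMinus q τ)) =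
        -((((1 / (β * (L : ℝ) ^ 2) ^ 3 : ℝ) : ℂ)) *
          ((∑ q : FreqMomentum L M, propCT L M β μ 0 q ^ 2) * ∑ q : FreqMomentum L M, propCT L M β μ 0 q)) := by
    intro τ
    set C := hubbardCovariance L M β μ 0 with hC
    set W : HubbardGrassmann L M := hubbardInteraction L M β 1 with hW
    set c' : ℂ := (((1 / (β * (L : ℝ) ^ 2) ^ 3 : ℝ) : ℂ)) with hc'
    have hcomm : ∀ q : FreqMomentum L M, W * (psiPlus q τ * psiMinus q τ) = psiPlus q τ * psiMinus q τ * W := fun q =>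
      (commute_of_mem_evenOdd_zero ℂ (hubbardInteraction_mem_evenOdd_zero L M β 1) _).eq
    have hT : ∀ q : FreqMomentum L M,
        gaussExpect ℂ C (psiPlus q τ * psiMinus q τ * W) - gaussExpect ℂ C (psiPlus q τ * psiMinus q τ) * gaussExpect ℂ C W =
          propCT L M β μ 0 q ^ 2 * ∑ q' : FreqMomentum L M, propCT L M β μ 0 q' := fun q =>
      truncated_firstOrder_insertion_eq hβ μ q τ
    have h1 : gaussExpect ℂ C (W * -(c' • ∑ q : FreqMomentum L M, psiPlus q τ * psiMinus q τ)) =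
        -(c' * ∑ q : FreqMomentum L M, gaussExpect ℂ C (psiPlus q τ * psiMinus q τ * W)) := by
      rw [mul_neg, map_neg, mul_smul_comm, map_smul, Finset.mul_sum, map_sum, smul_eq_mul]
      simp only [hcomm]
    have h2 : gaussExpect ℂ C (-(c' • ∑ q : FreqMomentum L M, psiPlus q τ * psiMinus q τ)) =
        -(c' * ∑ q : FreqMomentum L M, gaussExpect ℂ C (psiPlus q τ * psiMinus q τ)) := by
      rw [map_neg, map_smul, map_sum, smul_eq_mul]
    rw [h1, h2]
    calc -(c' * ∑ q : FreqMomentum L M, gaussExpect ℂ C (psiPlus q τ * psiMinus q τ * W)) -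
          gaussExpect ℂ C W * -(c' * ∑ q : FreqMomentum L M, gaussExpect ℂ C (psiPlus q τ * psiMinus q τ))
          = -(c' * ∑ q : FreqMomentum L M, (gaussExpect ℂ C (psiPlus q τ * psiMinus q τ * W) -
              gaussExpect ℂ C (psiPlus q τ * psiMinus q τ) * gaussExpect ℂ C W)) := by
            rw [Finset.sum_sub_distrib, ← Finset.sum_mul]; ring
      _ = -(c' * ∑ q : FreqMomentum L M, propCT L M β μ 0 q ^ 2 * ∑ q' : FreqMomentum L M, propCT L M β μ 0 q') := by
            simp only [hT]
      _ = -(c' * ((∑ q : FreqMomentum L M, propCT L M β μ 0 q ^ 2) * ∑ q : FreqMomentum L M, propCT L M β μ 0 q)) := by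
            rw [← Finset.sum_mul]
  fin_cases σ
  · simp only [Fin.zero_eta, Fin.isValue, dd_up_hubbardInteraction]; exact key 1
  · simp only [Fin.mk_one, Fin.isValue, dd_down_hubbardInteraction]; exact key 0

/-! ## §3b A two-point value used by the six-point functions -/

/-- `∫dμ_{C^K} ψ̂⁻_{qσ} ψ̂⁺_{q'σ'} = [q' = q ∧ σ' = σ]·(+βL² ĝ_K(q))`. -/
theorem gaussExpect_psiMinus_psiPlus {β : ℝ} (hβ : β ≠ 0) (μ : ℝ) (K : TrigPolyC4v) (q q' : FreqMomentum L M) (σ σ' : Fin 2) :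
    gaussExpect ℂ (hubbardCovarianceCT L M β μ 0 K)
        (gen ℂ (((q, σ), 1) : HubbardFieldIdx L M) * gen ℂ (((q', σ'), 0) : HubbardFieldIdx L M)) =
      if q' = q ∧ σ' = σ then ((β * (L : ℝ) ^ 2 : ℝ) : ℂ) * propCT L M β μ K q else 0 := by
  rw [gaussExpect_psiMinus_mul hβ, grassmannDeriv_gen, apply_ite (gaussExpect ℂ (hubbardCovarianceCT L M β μ 0 K)), gaussExpect_one,
    map_zero]
  by_cases h : q' = q ∧ σ' = σ
  · rw [if_pos h, if_pos (by rw [h.1, h.2]), mul_one]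
  · rw [if_neg h, if_neg (fun h' => h ?_), mul_zero]
    simp only [Prod.mk.injEq] at h'
    exact ⟨h'.1.1.symm, h'.1.2.symm⟩

end Summit.HubbardSuperconductivity.HubbardSuperconductivity.Theorems.TwoPointAssembly

end
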